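import Mathlib

/-!
# Rotation invariance of the standard Gaussian jitter law on `ℝ × ℝ`

Helper for the crux `QuadrupoleSelectionRule` (stmt-CriticalPhenomena-7029), route `CardyFlipRusso`,
sub-problem `CardyFormulaZ2`, line `Sketch`, stub S1.

The single-site jitter law of the jittered triangular leg is the standard two-dimensional Gaussian
`N(0,1) ⊗ N(0,1)` on `ℝ × ℝ` (the measure `(gaussianReal 0 1).prod (gaussianReal 0 1)`).  Card A
("partial rotation" symmetry) needs its invariance under the rotation of the plane by an angle `θ`
(used at `θ = π / 3`):

* `gaussianJitter_map_rotate` — the push-forward of `N(0,1) ⊗ N(0,1)` under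
  `(x, y) ↦ (cos θ · x - sin θ · y, sin θ · x + cos θ · y)` is `N(0,1) ⊗ N(0,1)`.

Proof: identify `ℝ × ℝ` with `ℂ` through `z ↦ (re z, im z)`.  By Mathlib's basis independence of
the standard Gaussian (`ProbabilityTheory.stdGaussian_eq_map_pi_orthonormalBasis`, applied to the
orthonormal basis `(1, I)` of `ℂ`) and `MeasureTheory.measurePreserving_finTwoArrow`, the product law
is the image of `stdGaussian ℂ` under `z ↦ (re z, im z)`; the rotation of the plane is conjugate to
the multiplication by `exp (θ I)` on `ℂ`, a linear isometry (`rotation (Circle.exp θ)`), which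
preserves `stdGaussian ℂ` (`ProbabilityTheory.stdGaussian_map`).
-/

noncomputable section

open MeasureTheory ProbabilityTheory

namespace Summit.CriticalPhenomena.CardyFormulaZ2.Theorems

/-- The law `N(0,1) ⊗ N(0,1)` on `ℝ × ℝ` is the image of the standard Gaussian of the real inner
product space `ℂ` under `z ↦ (re z, im z)`. [folklore] -/
theorem gaussianReal_prod_eq_map_stdGaussian_complex :
    (gaussianReal 0 1).prod (gaussianReal 0 1) =
      (stdGaussian ℂ).map (fun z : ℂ => (z.re, z.im)) := by
  rw [stdGaussian_eq_map_pi_orthonormalBasis Complex.orthonormalBasisOneI,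
    Measure.map_map (by fun_prop) (by fun_prop)]
  have h : (fun z : ℂ => (z.re, z.im)) ∘
      (fun x : Fin 2 → ℝ => ∑ i, x i • Complex.orthonormalBasisOneI i) =
        ⇑(MeasurableEquiv.finTwoArrow : (Fin 2 → ℝ) ≃ᵐ ℝ × ℝ) := by
    funext x
    simp [Fin.sum_univ_two]
  rw [h, (measurePreserving_finTwoArrow (gaussianReal 0 1)).map_eq]

/-- **Isotropy of the standard planar Gaussian**: the jitter law `N(0,1) ⊗ N(0,1)` on `ℝ × ℝ` is
invariant under the rotation of the plane by any angle `θ`. [folklore] -/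
theorem gaussianJitter_map_rotate (θ : ℝ) :
    ((ProbabilityTheory.gaussianReal 0 1).prod (ProbabilityTheory.gaussianReal 0 1)).map
        (fun v : ℝ × ℝ => (Real.cos θ * v.1 - Real.sin θ * v.2, Real.sin θ * v.1 + Real.cos θ * v.2))
      = (ProbabilityTheory.gaussianReal 0 1).prod (ProbabilityTheory.gaussianReal 0 1) := by
  rw [gaussianReal_prod_eq_map_stdGaussian_complex, Measure.map_map (by fun_prop) (by fun_prop)]
  have h : (fun v : ℝ × ℝ =>
      (Real.cos θ * v.1 - Real.sin θ * v.2, Real.sin θ * v.1 + Real.cos θ * v.2)) ∘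
        (fun z : ℂ => (z.re, z.im)) =
      (fun z : ℂ => (z.re, z.im)) ∘ ⇑(rotation (Circle.exp θ)) := by
    funext z
    simp only [Function.comp_apply, rotation_apply, Circle.coe_exp, Complex.mul_re, Complex.mul_im,
      Complex.exp_ofReal_mul_I_re, Complex.exp_ofReal_mul_I_im, Prod.mk.injEq, true_and]
    ring
  rw [h, ← Measure.map_map (by fun_prop) (rotation (Circle.exp θ)).continuous.measurable,
    stdGaussian_map (rotation (Circle.exp θ))]

end Summit.CriticalPhenomena.CardyFormulaZ2.Theorems
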